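import Summits.BirchSwinnertonDyer.Rank1Residual.X11b.SelmerLocalKerCoprimeDescent
import Literature.NumberTheory.EllipticCurves.MazurRubin2015.KummerImageGoodReduction
import HarnessLib

/-!
# The one-directional local inclusion AT `v ∣ p` for a congruent pair acquiring GOOD reduction
# over a small extension (class X11b, cell `b2b-bsdres`, unit `b2b-bsdres-sha-2`, gen 28; part (e5))

HONEST FRAMING (run/shared/lean/b2b/bsd-rank1-residual/, verbatim in every file): prove what is
provable now; shrink each hard class to its core with data; no claim beyond stated classes. TOOL
theorems for the residual place `v = p` of the 27 'PG/PG at p' rows of the Ш-census typing inventory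
(sha-2 GEN 27 `RESIDUAL-28.md`): nothing is booked by this file; no label / mark / count moves; no
named fact is added (the only non-elementary input is the REGISTERED named fact A308
`MazurRubin2015.selmerLocalKer_iff_of_goodReduction_above`, taken as a hypothesis `hMR`); no `sorry`;
ONE bookkeeping definition (`baseChangeTorsionEquiv`, the transported torsion isomorphism).

## What

For `p`-congruent elliptic curves `W`, `Y` over `ℚ` (a `Γ_ℚ`-isomorphism `θ : W[p] ⥲ Y[p]`) that are
both ADDITIVE, potentially good at `p`, no local statement at `v = p` comparing the Kummer conditions
is in the tree (kind (vii) and Mazur–Rubin §5.1 need `v ∤ p`). If both curves acquire GOOD reduction at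
every place `w ∣ p` of a number field `K'` with `[K' : ℚ] < p − 1` (for the 27 rows: `K' = ℚ(√5)`,
`ℚ(∛5)`, `ℚ(∛7)`, semistability defect `e ∈ {2, 3}`), the comparison is an ASSEMBLY of in-tree
statements:

* §1 `index_finGalSubgroup_dvd_factorial_finrank` — `[Γ_E : Γ_{Ẽ'}] ∣ [E' : E]!` for a finite
  extension `E'/E` of characteristic `0` (`Γ_E` permutes the `[E' : E]` embeddings `E' → Ē`; the kernel
  of this action fixes the Galois closure `Ẽ' = ⨆_f f(E')`); sharper than the tree's `≤ [E' : E]^[E' : E]`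
  (`index_finGalSubgroup_le_pow`) and what makes degree-`3` fields usable at `p = 5, 7`.
* §2 `baseChangeTorsionEquiv` — `θ' : W_{K'}[p] ⥲ Y_{K'}[p]`, the transport of `θ` along the torsion
  comparisons `torsionTransferEquiv`; it is `Γ_{K'}`-equivariant (`baseChangeTorsionEquiv_smul`) and
  `res ∘ θ_* = θ'_* ∘ res` on `H¹` (`resBaseChangeTorsion_h1Equiv`; functoriality `resH1Hom_resH1Hom`).
* §3 `localLe_of_goodReduction_above_tower` — THE KIND LEMMA (general base number field `K`,
  extension `K'/K` with `[K' : K] < p`, `e(w|p) < p − 1` and good reduction of both base changes at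
  every `w ∣ p`): for `v ∣ p`, a class `c ∈ H¹(K, W[p])` with the local Selmer condition of `W` at `K_v`
  has `θ_* c` with the local Selmer condition of `Y` at `K_v`.  Chain: pick `w ∣ v` in `K'`
  (`exists_liesOver`); the condition grows to `K'_w` (`selmerLocalKer_le_of_tower`), corresponds under
  restriction to `K'` (`mem_selmerLocalKer_iff_resBaseChangeTorsion_mem`), is matched by A308 over
  `K'` at `w`, and descends from `K'_w` to `K_v` because `[Γ_{K_v} : Γ_{closure of K'_w}] ∣
  [K'_w : K_v]!`, `[K'_w : K_v] ≤ [K' : K] < p`, is prime to `p` (§1 + part (e4)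
  `selmerLocalKer_le_of_tower_of_coprime_index`).  Over `ℚ` (`localLe_of_goodReduction_above_tower_rat`)
  the single numeric hypothesis is `[K' : ℚ] < p − 1` (`e(w|p) ≤ [K' : ℚ]`, Mathlib
  `Ideal.ramificationIdx_le_finrank`, packaged as `ramificationIdx_int_le_finrank`).  This is exactly
  the `(d3)` disjunct of the GEN 27 consumers `bsdp_of_congruent_*_localLe` at the place over `p` (and
  `(u3)` with `W`, `Y` swapped); what remains per row is the good-reduction certificate of the two
  base changes at `w ∣ p` (a rescaled integral model with unit discriminant at `w`).

References: B. Mazur, K. Rubin, *Selmer companion curves*, Trans. AMS 367 (2015), Thm. 3.1 and §6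
Case 5 [MazurRubin2015SelmerCompanions] (arXiv:1203.0620); J.-P. Serre, *Galois Cohomology* I.§2.4,
II.§1.1 [SerreGaloisCohomology1997]; J.-P. Serre, J. Tate, *Good reduction of abelian varieties*,
Ann. of Math. 88 (1968) §2 (semistable reduction over a tame extension); J. H. Silverman, *AEC*
VII.5 Prop. 5.4 [SilvermanAEC2009].
-/

set_option autoImplicit false

noncomputable section

open scoped Classical

universe u

open Field WeierstrassCurve NumberField IsDedekindDomain IntermediateField
open Literature.NumberTheory.EllipticCurves
open Literature.NumberTheory.GaloisRepresentations

namespace Summit.BirchSwinnertonDyer.Rank1Residual.X11b.CongruentTransfer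

/-! ### §1 `[Γ_E : Γ_{Ẽ'}] ∣ [E' : E]!` -/

section Index

variable {E : Type u} [Field E] [CharZero E] (E' : Type u) [Field E'] [Algebra E E']
  [FiniteDimensional E E']

/-- **`[Γ_E : Γ_{Ẽ'}]` divides `[E' : E]!`** (characteristic `0`): `Γ_E = Gal(Ē/E)` permutes the
`[E' : E]` embeddings `E' → Ē` (`AlgHom.card`) by composition; an element acting trivially fixes every
`f(E')`, hence the Galois closure `Ẽ' = ⨆_f f(E')` (`normalClosure_def`), i.e. lies in `Γ_{Ẽ'}`; so
`[Γ_E : Γ_{Ẽ'}]` divides the order of the image in the symmetric group, which divides `[E' : E]!`.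
Serre, *Galois Cohomology*, II.§1.1. [folklore] -/
theorem index_finGalSubgroup_dvd_factorial_finrank :
    (finGalSubgroup (E := E) E').index ∣ (Module.finrank E E').factorial := by
  -- the permutation action of `Gal(Ē/E)` on the embeddings `E' → Ē`
  let φ : (AlgebraicClosure E ≃ₐ[E] AlgebraicClosure E) →*
      Equiv.Perm (E' →ₐ[E] AlgebraicClosure E) :=
    { toFun := fun σ =>
        { toFun := fun f => (σ : AlgebraicClosure E →ₐ[E] AlgebraicClosure E).comp f
          invFun := fun f => (σ.symm : AlgebraicClosure E →ₐ[E] AlgebraicClosure E).comp f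
          left_inv := fun f => by ext x; simp
          right_inv := fun f => by ext x; simp }
      map_one' := by ext f x; rfl
      map_mul' := fun σ τ => by ext f x; rfl }
  -- its kernel fixes `Ẽ' = ⨆_f f(E')` pointwise
  have hker : φ.ker ≤ (finGaloisClosure (E := E) E').fixingSubgroup := by
    rw [← IntermediateField.le_iff_le]
    unfold finGaloisClosure
    rw [normalClosure_def]
    refine iSup_le fun f => ?_
    intro x hx
    obtain ⟨y, rfl⟩ := AlgHom.mem_fieldRange.mp hx
    rw [IntermediateField.mem_fixedField_iff]
    intro σ hσ
    have h := MonoidHom.mem_ker.mp hσ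
    have h' : (σ : AlgebraicClosure E →ₐ[E] AlgebraicClosure E).comp f = f :=
      congrArg (fun π : Equiv.Perm (E' →ₐ[E] AlgebraicClosure E) => π f) h
    exact DFunLike.congr_fun h' y
  -- so the index divides `|image| ∣ |Perm| = [E' : E]!`
  have hdvd : ((finGaloisClosure (E := E) E').fixingSubgroup).index ∣
      (Module.finrank E E').factorial :=
    calc ((finGaloisClosure (E := E) E').fixingSubgroup).index
        ∣ φ.ker.index := Subgroup.index_dvd_of_le hker
      _ = Nat.card φ.range := Subgroup.index_ker φ
      _ ∣ Nat.card (Equiv.Perm (E' →ₐ[E] AlgebraicClosure E)) :=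
          Subgroup.card_subgroup_dvd_card φ.range
      _ = (Module.finrank E E').factorial := by
          rw [Nat.card_eq_fintype_card, Fintype.card_perm, AlgHom.card]
  exact hdvd

/-- **Prime-to-`p` index from a degree bound**: if `[E' : E] < p` then `[Γ_E : Γ_{Ẽ'}]` is prime to
the prime `p` (it divides `[E' : E]!`, §1). [folklore] -/
theorem coprime_index_finGalSubgroup_of_finrank_lt {p : ℕ} (hp : p.Prime)
    (h : Module.finrank E E' < p) :
    Nat.Coprime (finGalSubgroup (E := E) E').index p := by
  have h1 := index_finGalSubgroup_dvd_factorial_finrank (E := E) E'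
  have h2 : Nat.Coprime (Module.finrank E E').factorial p := by
    rw [Nat.coprime_comm, Nat.Prime.coprime_iff_not_dvd hp, Nat.Prime.dvd_factorial hp]
    omega
  exact Nat.Coprime.coprime_dvd_left h1 h2

end Index

/-! ### §2 The transported torsion isomorphism over a base change -/

section Transport

variable {K : Type u} [Field K] [CharZero K] (W Y : WeierstrassCurve K) [W.IsElliptic] [Y.IsElliptic]
  (L : Type u) [Field L] [Algebra K L] {n : ℤ} (hn : n ≠ 0)

/-- **`θ' : W_L[n] ⥲ Y_L[n]`**, the transport of `θ : W[n] ⥲ Y[n]` along the torsion comparisons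
`W[n](K̄) ≃ W_L[n](L̄)`, `Y[n](K̄) ≃ Y_L[n](L̄)` (`torsionTransferEquiv`). [folklore] -/
def baseChangeTorsionEquiv (θ : geomTorsion W n ≃+ geomTorsion Y n) :
    geomTorsion (W.baseChange L) n ≃+ geomTorsion (Y.baseChange L) n :=
  ((W.torsionTransferEquiv (E := L) hn).symm.trans θ).trans (Y.torsionTransferEquiv (E := L) hn)

/-- `θ'` is `Γ_L`-equivariant when `θ` is `Γ_K`-equivariant (`Γ_L → Γ_K` the restriction;
`torsionTransferEquiv_smul`, `torsionTransferEquiv_symm_smul`). [folklore] -/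
theorem baseChangeTorsionEquiv_smul (θ : geomTorsion W n ≃+ geomTorsion Y n)
    (hθ : ∀ (σ : absoluteGaloisGroup K) (P : geomTorsion W n), θ (σ • P) = σ • θ P)
    (σ : absoluteGaloisGroup L) (P : geomTorsion (W.baseChange L) n) :
    baseChangeTorsionEquiv W Y L hn θ (σ • P) = σ • baseChangeTorsionEquiv W Y L hn θ P := by
  simp only [baseChangeTorsionEquiv, AddEquiv.trans_apply]
  rw [torsionTransferEquiv_symm_smul, hθ, torsionTransferEquiv_smul]

/-- The underlying additive map of `θ'` composed with the torsion comparison of `W` is the torsion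
comparison of `Y` composed with `θ`. [folklore] -/
theorem baseChangeTorsionEquiv_comp (θ : geomTorsion W n ≃+ geomTorsion Y n) :
    ((baseChangeTorsionEquiv W Y L hn θ : geomTorsion (W.baseChange L) n ≃+
        geomTorsion (Y.baseChange L) n) :
        geomTorsion (W.baseChange L) n →+ geomTorsion (Y.baseChange L) n).comp
      ((W.torsionTransferEquiv (E := L) hn : geomTorsion W n ≃+ geomTorsion (W.baseChange L) n) :
        geomTorsion W n →+ geomTorsion (W.baseChange L) n) =
    ((Y.torsionTransferEquiv (E := L) hn : geomTorsion Y n ≃+ geomTorsion (Y.baseChange L) n) :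
        geomTorsion Y n →+ geomTorsion (Y.baseChange L) n).comp (θ : geomTorsion W n →+ geomTorsion Y n) := by
  ext P
  simp [baseChangeTorsionEquiv]

/-- **Restriction to `L` intertwines `θ_*` and `θ'_*` on `H¹`**:
`res_{L/K} (θ_* c) = θ'_* (res_{L/K} c)` for `c ∈ H¹(K, W[n])` (both sides are the map of the
compatible pair `(Γ_L → Γ_K, (Y-comparison) ∘ θ = θ' ∘ (W-comparison))`; `resH1Hom_resH1Hom`,
`resH1Hom_congr`). Serre, *Galois Cohomology*, I.§2.4. [folklore] -/
theorem resBaseChangeTorsion_h1Equiv (θ : geomTorsion W n ≃+ geomTorsion Y n)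
    (hθ : ∀ (σ : absoluteGaloisGroup K) (P : geomTorsion W n), θ (σ • P) = σ • θ P)
    (c : galH1Torsion W n) :
    resBaseChangeTorsion Y L hn (h1Equiv θ hθ c) =
      h1Equiv (baseChangeTorsionEquiv W Y L hn θ) (baseChangeTorsionEquiv_smul W Y L hn θ hθ)
        (resBaseChangeTorsion W L hn c) := by
  rw [h1Equiv_apply, h1Equiv_apply]
  unfold resBaseChangeTorsion
  rw [resH1Hom_resH1Hom, resH1Hom_resH1Hom]
  exact DFunLike.congr_fun (resH1Hom_congr (by ext; rfl)
    (baseChangeTorsionEquiv_comp W Y L hn θ).symm _ _) c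

end Transport

/-! ### §3 The kind lemma at `v ∣ p` -/

section Above

/-- **The one-directional local inclusion at `v ∣ p` from GOOD reduction over a small extension**
(general base). Let `p` be an odd prime, `W`, `Y` elliptic curves over a number field `K` with a
`Γ_K`-isomorphism `θ : W[p] ⥲ Y[p]`, and `K'/K` an extension with `[K' : K] < p` such that at every
place `w ∣ p` of `K'`: `e(w|p) < p − 1` and the base changes `W_{K'}`, `Y_{K'}` have GOOD reduction.
Then at every place `v ∣ p` of `K`, a class `c ∈ H¹(K, W[p])` satisfying the local Selmer condition
of `W` at `K_v` has `θ_* c` satisfying that of `Y` at `K_v`.  Proof: choose `w ∣ v`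
(`exists_liesOver`); the condition persists at `K'_w ⊇ K_v` (`selmerLocalKer_le_of_tower`); under
restriction to `K'` it is the local condition of `W_{K'}` at `w`
(`mem_selmerLocalKer_iff_resBaseChangeTorsion_mem`), matched with that of `Y_{K'}` by Mazur–Rubin
Thm. 3.1 / §6 Case 5 (A308 `hMR`; both good at `w`, `e(w|p) < p − 1`; `res ∘ θ_* = θ'_* ∘ res`, §2),
i.e. `θ_* c` has the condition of `Y` at `K'_w`; and it DESCENDS to `K_v` since
`[Γ_{K_v} : Γ_{(K'_w)~}] ∣ [K'_w : K_v]!`, `[K'_w : K_v] ≤ [K' : K] < p`, is prime to `p` (§1, part (e4)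
`selmerLocalKer_le_of_tower_of_coprime_index`). Conditional on the named fact A308 only.
[cite: MazurRubin2015SelmerCompanions, Thm. 3.1 (iv)(b) and §6 proof Case 5]
[cite: SerreGaloisCohomology1997, I.§2.4 Cor. to Prop. 9] -/
theorem localLe_of_goodReduction_above_tower
    (hMR : MazurRubin2015.selmerLocalKer_iff_of_goodReduction_above)
    {p : ℕ} [hp : Fact p.Prime] (hp2 : p ≠ 2)
    {K : Type} [Field K] [NumberField K] (W Y : WeierstrassCurve K) [W.IsElliptic] [Y.IsElliptic]
    (K' : Type) [Field K'] [NumberField K'] [Algebra K K'] (hdeg : Module.finrank K K' < p)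
    (hram : ∀ w : HeightOneSpectrum (𝓞 K'), ((p : ℕ) : 𝓞 K') ∈ w.asIdeal →
      w.asIdeal.ramificationIdx ℤ < p - 1)
    (hW : ∀ w : HeightOneSpectrum (𝓞 K'), ((p : ℕ) : 𝓞 K') ∈ w.asIdeal →
      (W.baseChange K').HasGoodReductionAt w)
    (hY : ∀ w : HeightOneSpectrum (𝓞 K'), ((p : ℕ) : 𝓞 K') ∈ w.asIdeal →
      (Y.baseChange K').HasGoodReductionAt w)
    (θ : geomTorsion W (p : ℤ) ≃+ geomTorsion Y (p : ℤ))
    (hθ : ∀ (σ : absoluteGaloisGroup K) (P : geomTorsion W (p : ℤ)), θ (σ • P) = σ • θ P)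
    (v : HeightOneSpectrum (𝓞 K)) (hv : ((p : ℕ) : 𝓞 K) ∈ v.asIdeal)
    (c : galH1Torsion W (p : ℤ)) (hc : c ∈ selmerLocalKer W (v.adicCompletion K) (p : ℤ)) :
    h1Equiv θ hθ c ∈ selmerLocalKer Y (v.adicCompletion K) (p : ℤ) := by
  have hp0 : ((p : ℕ) : ℤ) ≠ 0 := by exact_mod_cast hp.out.ne_zero
  -- a place `w ∣ v` of `K'` and the tower `K_v → K'_w`
  obtain ⟨w, hwv⟩ := exists_liesOver K' v
  haveI := hwv
  obtain ⟨hfin, hle⟩ := finrank_adicCompletion_le_of_liesOver K' v w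
  letI : Algebra (v.adicCompletion K) (w.adicCompletion K') :=
    (adicCompletionMap (K := K) K' v w).toAlgebra
  haveI : IsScalarTower K (v.adicCompletion K) (w.adicCompletion K') :=
    IsScalarTower.of_algebraMap_eq fun x ↦ (adicCompletionMap_coe (K := K) K' v w x).symm
  haveI : FiniteDimensional (v.adicCompletion K) (w.adicCompletion K') := hfin
  haveI : CharZero (v.adicCompletion K) :=
    charZero_of_injective_algebraMap (algebraMap K (v.adicCompletion K)).injective
  -- `p ∈ w`
  have hpw : ((p : ℕ) : 𝓞 K') ∈ w.asIdeal := by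
    have h : ((p : ℕ) : 𝓞 K) ∈ w.asIdeal.under (𝓞 K) := by rw [← hwv.over]; exact hv
    rw [Ideal.under_def, Ideal.mem_comap, map_natCast] at h
    exact h
  -- `[Γ_{K_v} : Γ_{(K'_w)~}]` is prime to `p`
  have hcop : Nat.Coprime
      (finGalSubgroup (E := v.adicCompletion K) (w.adicCompletion K')).index p :=
    coprime_index_finGalSubgroup_of_finrank_lt (E := v.adicCompletion K) (w.adicCompletion K')
      hp.out (lt_of_le_of_lt hle hdeg)
  -- the inclusion at the UPPER field `K'_w`, via restriction to `K'` and A308 at `w`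
  haveI : (W.baseChange K').IsElliptic := by rw [baseChange]; infer_instance
  haveI : (Y.baseChange K').IsElliptic := by rw [baseChange]; infer_instance
  have hup : ∀ c' : galH1Torsion W (p : ℤ), c' ∈ selmerLocalKer W (w.adicCompletion K') (p : ℤ) →
      h1Equiv θ hθ c' ∈ selmerLocalKer Y (w.adicCompletion K') (p : ℤ) := by
    intro c' hc'
    rw [mem_selmerLocalKer_iff_resBaseChangeTorsion_mem W (L := K') hp0 c'] at hc'
    rw [mem_selmerLocalKer_iff_resBaseChangeTorsion_mem Y (L := K') hp0,
      resBaseChangeTorsion_h1Equiv W Y K' hp0 θ hθ c']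
    exact (hMR (Y.baseChange K') (W.baseChange K') p hp2 (baseChangeTorsionEquiv W Y K' hp0 θ)
      (baseChangeTorsionEquiv_smul W Y K' hp0 θ hθ) w hpw (hram w hpw) (hY w hpw) (hW w hpw) _).mp
      hc'
  -- DESCENT from `K'_w` to `K_v`
  exact selmerLocalKer_le_of_tower_of_coprime_index Y p hcop
    (hup c (selmerLocalKer_le_of_tower W (p : ℤ) hc))

/-- **Absolute ramification below the degree**: for a place `w ∣ p` of a number field `K'`,
`e(w|p) ≤ [K' : ℚ]` (Mathlib `Ideal.ramificationIdx_le_finrank`). [folklore] -/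
theorem ramificationIdx_int_le_finrank (K' : Type) [Field K'] [NumberField K'] {p : ℕ} (hp : p.Prime)
    (w : HeightOneSpectrum (𝓞 K')) (hpw : ((p : ℕ) : 𝓞 K') ∈ w.asIdeal) :
    w.asIdeal.ramificationIdx ℤ ≤ Module.finrank ℚ K' := by
  haveI := w.isMaximal
  set P : Ideal ℤ := w.asIdeal.under ℤ with hPdef
  haveI : w.asIdeal.LiesOver P := ⟨hPdef⟩
  haveI : P.IsMaximal := Ideal.IsMaximal.under ℤ w.asIdeal
  have hP0 : P ≠ ⊥ := by
    intro h0
    have hmem : ((p : ℕ) : ℤ) ∈ P := by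
      rw [hPdef, Ideal.under_def, Ideal.mem_comap, map_natCast]
      exact hpw
    rw [h0, Ideal.mem_bot] at hmem
    exact hp.ne_zero (by exact_mod_cast hmem)
  have h := Ideal.ramificationIdx_le_finrank (S := 𝓞 K') ℚ K' w.asIdeal (p := P)
  rwa [Ideal.ramificationIdx'_eq_ramificationIdx P w.asIdeal hP0] at h

/-- **The kind lemma over `ℚ`** — the `(d3)` disjunct at the place over `p` of the GEN 27 consumers
`bsdp_of_congruent_*_localLe` (and `(u3)` with `W`, `Y` swapped): for an odd prime `p`, `p`-congruent
`W`, `Y` over `ℚ`, and a number field `K'` with `[K' : ℚ] < p − 1` over which both acquire GOOD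
reduction at every `w ∣ p`, the local Selmer condition of `W` at `ℚ_v` (`v ∣ p`) implies that of `Y`
for `θ_* c`.  (`e(w|p) ≤ [K' : ℚ] < p − 1`, `ramificationIdx_int_le_finrank`; then the general lemma.)
For the 27 RESIDUAL-28 'PG/PG at p' rows: `K' = ℚ(√5)` (`p = 5`, types `I₀*`/`I₀*`), `ℚ(∛5)`
(`p = 5`, `IV|IV*`), `ℚ(∛7)` (`p = 7`, `IV|IV*`). Conditional on the named fact A308 only.
[cite: MazurRubin2015SelmerCompanions, Thm. 3.1 (iv)(b) and §6 proof Case 5] -/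
theorem localLe_of_goodReduction_above_tower_rat
    (hMR : MazurRubin2015.selmerLocalKer_iff_of_goodReduction_above)
    {p : ℕ} [hp : Fact p.Prime] (hp2 : p ≠ 2) (W Y : WeierstrassCurve ℚ) [W.IsElliptic] [Y.IsElliptic]
    (K' : Type) [Field K'] [NumberField K'] (hdeg : Module.finrank ℚ K' < p - 1)
    (hW : ∀ w : HeightOneSpectrum (𝓞 K'), ((p : ℕ) : 𝓞 K') ∈ w.asIdeal →
      (W.baseChange K').HasGoodReductionAt w)
    (hY : ∀ w : HeightOneSpectrum (𝓞 K'), ((p : ℕ) : 𝓞 K') ∈ w.asIdeal →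
      (Y.baseChange K').HasGoodReductionAt w)
    (θ : geomTorsion W (p : ℤ) ≃+ geomTorsion Y (p : ℤ))
    (hθ : ∀ (σ : absoluteGaloisGroup ℚ) (P : geomTorsion W (p : ℤ)), θ (σ • P) = σ • θ P)
    (v : HeightOneSpectrum (𝓞 ℚ)) (hv : ((p : ℕ) : 𝓞 ℚ) ∈ v.asIdeal)
    (c : galH1Torsion W (p : ℤ)) (hc : c ∈ selmerLocalKer W (v.adicCompletion ℚ) (p : ℤ)) :
    h1Equiv θ hθ c ∈ selmerLocalKer Y (v.adicCompletion ℚ) (p : ℤ) :=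
  localLe_of_goodReduction_above_tower hMR hp2 W Y K' (by omega)
    (fun w hpw => lt_of_le_of_lt (ramificationIdx_int_le_finrank K' hp.out w hpw) hdeg)
    hW hY θ hθ v hv c hc

end Above

end Summit.BirchSwinnertonDyer.Rank1Residual.X11b.CongruentTransfer

end
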